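import Summits.Schanuel.Schanuel.Theorems.ZilberEacAxisLogDensity
import Summits.Schanuel.Schanuel.Theorems.ZilberEacHyperplaneComplete
import HarnessLib

/-!
# THE PLANE THEOREM: `{x₂ = r₀x₀ + r₁x₁ + c, yⱼ = xⱼ + y₂Fⱼ(y₂)}` is dense for EVERY plane with a
# non-rational coefficient

Zilber's Exponential-Algebraic Closedness, case ladder (host summit Schanuel, cell `pub-schanuel`,
seat 2, gen 15; closes HANDOFF O59/O60 (i) for the targets `Xⱼ`).  THE FAMILY (`F₀, F₁ ∈ ℂ[u] ∖ 0`,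
`r₀, r₁ ∈ ℂ`, `c ∈ ℂ`):

  `W = {x₂ = r₀x₀ + r₁x₁ + c,  y₀ = x₀ + y₂F₀(y₂),  y₁ = x₁ + y₂F₁(y₂)} ⊆ ℂ³ × ℂ³`.

**THEOREM (`unprojectedDense_polyFibredGraph_plane_all`).**  If some `rⱼ ∉ ℚ` then
`I(W ∩ Γ_exp) = I(W)`.  (When both `rⱼ ∈ ℚ` the variety is not additively free — outside the cell.)
Assembly: a non-real coefficient — gen 9's negative lattice ray
(`unprojectedDense_polyFibredGraph_hyperplaneC`); real `r₀r₁ ≠ 0` — the master theorem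
(`unprojectedDense_polyFibredGraph_hyperplane_master`: slow / critical / cancelling / double
cancelling); the AXES `r₀r₁ = 0` — `unprojectedDense_polyFibredGraph_hyperplane_axis_all`: the slow
and cancelling regimes of `…_hyperplane_axis` (`r₀ < 0` or `r₀e₀ > 1`) and the NEW logarithmic-fibre
regime `unprojectedDense_polyFibredGraph_axisLog` (`0 < r₀e₀ < 1`; `r₀e₀ = 1` is impossible for
`r₀ ∉ ℚ`), transported to the other axis by the coordinate swap.

* `unprojectedDense_polyFibredGraph_hyperplane_axis_all`, `…_axis_all_swap`,
  **`unprojectedDense_polyFibredGraph_realPlane`** (real `(r₀, r₁)`, one irrational, no other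
  condition), **`unprojectedDense_polyFibredGraph_plane_all`** (complex coefficients),
  `polyFibredGraph_plane_all_member_dense`, example **`sqrtTwoQuarterAxis_member_dense`**
  `{x₂ = (√2/4)x₀, y₀ = x₀ + y₂², y₁ = x₁ + y₂³}` (`r₁ = 0`, `r₀e₀ = √2/2 < 1 < r₀e₁ = 3√2/4`:
  the axis case no earlier regime reached).

HONEST FRAMING: one explicit 3-fold family inside the OPEN cell `EC(3,2)`, now decided for every
admissible (= some coefficient irrational) plane and all nonzero fibre polynomials; zero fibre
polynomials in some ranges remain; `EC(3,2)` OPEN; NOT Schanuel's conjecture; EAC ⇏ SC.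
-/

noncomputable section

open Complex MvPolynomial Filter Topology
open Literature.NumberTheory.Transcendental Literature.ModelTheory.Zilber
  Literature.ModelTheory.ExponentialFields

set_option linter.dupNamespace false

namespace Summit.Schanuel.Schanuel.Theorems

section Plane

/-- An irrational number times a natural number is not `1`. [folklore] -/
theorem irrational_mul_natCast_ne_one {r : ℝ} (hr : Irrational r) (n : ℕ) : r * n ≠ 1 := by
  intro h
  have hn : (n : ℝ) ≠ 0 := by
    rintro h0
    rw [h0, mul_zero] at h
    exact zero_ne_one h
  exact hr ⟨1 / (n : ℚ), by push_cast; field_simp; linarith⟩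

/-- **THE AXIS `x₂ = r₀x₀ + c`, all cases**: `F₀F₁ ≠ 0`, `r₀ ∉ ℚ`, any `c` ⟹ dense (`r₀ < 0` or
`r₀e₀ > 1`: `…_hyperplane_axis`; `0 < r₀e₀ < 1`: the logarithmic-fibre regime). (new)
[cite: MantovaMasser2023, §1 p.5 (the open case dim π(V) = 2 in ℂ³×ℂˣ³)] -/
theorem unprojectedDense_polyFibredGraph_hyperplane_axis_all (F : Fin 2 → Polynomial ℂ)
    (hF0 : F 0 ≠ 0) (hF1 : F 1 ≠ 0) (r₀ : ℝ) (hirr : Irrational r₀) (c : ℂ) :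
    UnprojectedDense (polyFibredGraph (hyperplanePoly ![r₀, 0] c) (fun j => X j)
      (fun j => (F j).toMvPolynomial 0)) := by
  by_cases h : r₀ < 0 ∨ 1 < (((F 0).natDegree + 1 : ℕ) : ℝ) * r₀
  · exact unprojectedDense_polyFibredGraph_hyperplane_axis F hF0 r₀ hirr c h
  rw [not_or, not_lt, not_lt] at h
  have hr₀ : 0 < r₀ := lt_of_le_of_ne h.1 (Ne.symm hirr.ne_zero)
  have hne : r₀ * (((F 0).natDegree + 1 : ℕ) : ℝ) ≠ 1 := irrational_mul_natCast_ne_one hirr _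
  have hlt : r₀ * (((F 0).natDegree + 1 : ℕ) : ℝ) < 1 :=
    lt_of_le_of_ne (by rw [mul_comm]; exact h.2) hne
  exact unprojectedDense_polyFibredGraph_axisLog F hF1 r₀ hr₀ hirr hlt c

/-- **The other axis `x₂ = r₁x₁ + c`** (coordinate swap `0 ↔ 1`). (new) -/
theorem unprojectedDense_polyFibredGraph_hyperplane_axis_all_swap (F : Fin 2 → Polynomial ℂ)
    (hF0 : F 0 ≠ 0) (hF1 : F 1 ≠ 0) (r₁ : ℝ) (hirr : Irrational r₁) (c : ℂ) :
    UnprojectedDense (polyFibredGraph (hyperplanePoly ![0, r₁] c) (fun j => X j)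
      (fun j => (F j).toMvPolynomial 0)) := by
  have h := unprojectedDense_polyFibredGraph_hyperplane_axis_all (F ∘ Equiv.swap (0 : Fin 2) 1)
    (by simpa using hF1) (by simpa using hF0) r₁ hirr c
  rw [← unprojectedDense_compPerm_iff (Equiv.swap (0 : Fin 3) 1), polyFibredGraph_hyperplane_swap] at h
  exact h

/-- **EVERY REAL PLANE with an irrational coefficient**: `F₀F₁ ≠ 0`, `r₀ ∉ ℚ ∨ r₁ ∉ ℚ`, any
`c` ⟹ `I(W ∩ Γ_exp) = I(W)` — no condition on vanishing, signs or resonance. (new)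
[cite: MantovaMasser2023, §1 p.5 (the open case dim π(V) = 2 in ℂ³×ℂˣ³)] -/
theorem unprojectedDense_polyFibredGraph_realPlane (F : Fin 2 → Polynomial ℂ)
    (hF0 : F 0 ≠ 0) (hF1 : F 1 ≠ 0) (r₀ r₁ : ℝ) (hirr : Irrational r₀ ∨ Irrational r₁) (c : ℂ) :
    UnprojectedDense (polyFibredGraph (hyperplanePoly ![r₀, r₁] c) (fun j => X j)
      (fun j => (F j).toMvPolynomial 0)) := by
  by_cases h0 : r₀ = 0
  · subst h0
    have h1 : Irrational r₁ := hirr.resolve_left not_irrational_zero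
    exact unprojectedDense_polyFibredGraph_hyperplane_axis_all_swap F hF0 hF1 r₁ h1 c
  by_cases h1 : r₁ = 0
  · subst h1
    have h0' : Irrational r₀ := hirr.resolve_right not_irrational_zero
    exact unprojectedDense_polyFibredGraph_hyperplane_axis_all F hF0 hF1 r₀ h0' c
  exact unprojectedDense_polyFibredGraph_hyperplane_master F hF0 hF1 r₀ r₁ h0 h1 hirr c

/-- **THE PLANE THEOREM (complex coefficients).**  `F₀F₁ ≠ 0`, some `rⱼ ∉ ℚ`, any `c` ⟹
`I(W ∩ Γ_exp) = I(W)` for `W = {x₂ = r₀x₀ + r₁x₁ + c, yⱼ = xⱼ + y₂Fⱼ(y₂)}`. (new)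
[cite: MantovaMasser2023, §1 p.5 (the open case dim π(V) = 2 in ℂ³×ℂˣ³)] -/
theorem unprojectedDense_polyFibredGraph_plane_all (F : Fin 2 → Polynomial ℂ) (hF0 : F 0 ≠ 0)
    (hF1 : F 1 ≠ 0) (r : Fin 2 → ℂ) (hirr : ∃ i, ∀ ρ : ℚ, r i ≠ (ρ : ℂ)) (c : ℂ) :
    UnprojectedDense (polyFibredGraph (∑ i, C (r i) * X i + C c) (fun j => X j)
      (fun j => (F j).toMvPolynomial 0)) := by
  classical
  by_cases him : ∃ i, (r i).im ≠ 0
  · obtain ⟨q₀, hq₀0, hq₀⟩ := exists_latticeDir_of_im_ne_zero r him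
    exact unprojectedDense_polyFibredGraph_hyperplaneC r c q₀ hq₀0 hq₀ (fun j => X j)
      (fun j => X_ne_zero j) _
  have him' : ∀ i, (r i).im = 0 := fun i => by
    by_contra h
    exact him ⟨i, h⟩
  set rr : Fin 2 → ℝ := fun i => (r i).re with hrr
  have hr_eq : ∀ i, r i = ((rr i : ℝ) : ℂ) := fun i =>
    Complex.ext (by simp [hrr]) (by simp [hrr, him' i])
  have hW : (∑ i, C (r i) * X i + C c : MvPolynomial (Fin 2) ℂ) = hyperplanePoly ![rr 0, rr 1] c := by
    rw [hyperplanePoly, Fin.sum_univ_two, Fin.sum_univ_two]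
    simp only [Matrix.cons_val_zero, Matrix.cons_val_one]
    rw [hr_eq 0, hr_eq 1]
  rw [hW]
  have hirr_of : ∀ i, (∀ ρ : ℚ, r i ≠ (ρ : ℂ)) → Irrational (rr i) := by
    rintro i hi ⟨ρ, hρ⟩
    exact hi ρ (by rw [hr_eq i, ← hρ]; norm_cast)
  have hirr' : Irrational (rr 0) ∨ Irrational (rr 1) := by
    rcases Fin.exists_fin_two.1 hirr with h | h
    · exact Or.inl (hirr_of 0 h)
    · exact Or.inr (hirr_of 1 h)
  exact unprojectedDense_polyFibredGraph_realPlane F hF0 hF1 (rr 0) (rr 1) hirr' c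

/-- **Cell membership and density for every admissible plane**: `F₀F₁ ≠ 0`, some `rⱼ ∉ ℚ`, any
`c` ⟹ all seven hypotheses of `ECCell 3 2`, not linearly split, `W ∩ Γ_exp ≠ ∅`,
`I(W ∩ Γ_exp) = I(W)`. (new) [cite: MantovaMasser2023, §1 p.5 (the open case dim π(V) = 2 in ℂ³×ℂˣ³)] -/
theorem polyFibredGraph_plane_all_member_dense (F : Fin 2 → Polynomial ℂ) (hF0 : F 0 ≠ 0)
    (hF1 : F 1 ≠ 0) (r : Fin 2 → ℂ) (hirr : ∃ i, ∀ ρ : ℚ, r i ≠ (ρ : ℂ)) (c : ℂ) :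
    (IsIrreducibleClosed ℂ (polyFibredGraph (∑ i, C (r i) * X i + C c) (fun j => X j)
        (fun j => (F j).toMvPolynomial 0)) ∧
      (polyFibredGraph (∑ i, C (r i) * X i + C c) (fun j => X j) (fun j => (F j).toMvPolynomial 0) ∩
          torusLocus ℂ 3).Nonempty ∧
      IsRotund ℂ 3 (polyFibredGraph (∑ i, C (r i) * X i + C c) (fun j => X j)
          (fun j => (F j).toMvPolynomial 0) ∩ torusLocus ℂ 3) ∧
      IsAddFree ℂ 3 (polyFibredGraph (∑ i, C (r i) * X i + C c) (fun j => X j)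
          (fun j => (F j).toMvPolynomial 0) ∩ torusLocus ℂ 3) ∧
      IsMulFree ℂ 3 (polyFibredGraph (∑ i, C (r i) * X i + C c) (fun j => X j)
          (fun j => (F j).toMvPolynomial 0) ∩ torusLocus ℂ 3) ∧
      zariskiDim ℂ (polyFibredGraph (∑ i, C (r i) * X i + C c) (fun j => X j)
          (fun j => (F j).toMvPolynomial 0)) = (3 : ℕ) ∧
      addProjDim ℂ 3 (polyFibredGraph (∑ i, C (r i) * X i + C c) (fun j => X j)
          (fun j => (F j).toMvPolynomial 0)) = (2 : ℕ)) ∧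
    ¬ IsLinearSplit ℂ 3 (polyFibredGraph (∑ i, C (r i) * X i + C c) (fun j => X j)
        (fun j => (F j).toMvPolynomial 0)) ∧
    (polyFibredGraph (∑ i, C (r i) * X i + C c) (fun j => X j) (fun j => (F j).toMvPolynomial 0) ∩
        expGraph ℂ 3).Nonempty ∧
    UnprojectedDense (polyFibredGraph (∑ i, C (r i) * X i + C c) (fun j => X j)
        (fun j => (F j).toMvPolynomial 0)) := by
  have hA : Function.Injective (aeval (fun j : Fin 2 => (X j : MvPolynomial (Fin 2) ℂ)) :
      MvPolynomial (Fin 2) ℂ →ₐ[ℂ] MvPolynomial (Fin 2) ℂ) := by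
    rw [aeval_X_left]; exact fun _ _ h => h
  have hcell := ecCell_hypotheses_polyFibredGraph_hyperplaneC r c (fun j => X j)
    (fun j => (F j).toMvPolynomial 0) hA hirr
  have hdense := unprojectedDense_polyFibredGraph_plane_all F hF0 hF1 r hirr c
  refine ⟨hcell, not_isLinearSplit_polyFibredGraph _ (fun j => X j) _ (by norm_num) hA, ?_, hdense⟩
  obtain ⟨w, hw, -⟩ := hcell.2.1
  exact inter_expGraph_nonempty_of_vanishingIdeal_eq ⟨w, hw⟩ hdense

/-- **The axis member no earlier regime reached, dense**:
`W = {x₂ = (√2/4)x₀, y₀ = x₀ + y₂², y₁ = x₁ + y₂³}` (`r₁ = 0`, `r₀e₀ = √2/2 < 1 < 3√2/4 = r₀e₁`: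
fibre `0` slow, fibre `1` on its logarithmic branch): all seven hypotheses of `ECCell 3 2`, not
linearly split, `W ∩ Γ_exp ≠ ∅`, `I(W ∩ Γ_exp) = I(W)`. (new)
[cite: MantovaMasser2023, §1 p.5 (the open case dim π(V) = 2 in ℂ³×ℂˣ³)] -/
theorem sqrtTwoQuarterAxis_member_dense :
    let F : Fin 2 → Polynomial ℂ := ![Polynomial.X, Polynomial.X ^ 2]
    let W := polyFibredGraph (∑ i, C ((![((Real.sqrt 2 / 4 : ℝ) : ℂ), 0] : Fin 2 → ℂ) i) * X i + C 0)
      (fun j => X j) (fun j => (F j).toMvPolynomial 0)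
    (IsIrreducibleClosed ℂ W ∧ (W ∩ torusLocus ℂ 3).Nonempty ∧ IsRotund ℂ 3 (W ∩ torusLocus ℂ 3) ∧
        IsAddFree ℂ 3 (W ∩ torusLocus ℂ 3) ∧ IsMulFree ℂ 3 (W ∩ torusLocus ℂ 3) ∧
        zariskiDim ℂ W = (3 : ℕ) ∧ addProjDim ℂ 3 W = (2 : ℕ)) ∧
      ¬ IsLinearSplit ℂ 3 W ∧ (W ∩ expGraph ℂ 3).Nonempty ∧ UnprojectedDense W := by
  have hirr : Irrational (Real.sqrt 2 / 4) := by
    simpa using irrational_sqrt_two.div_natCast (m := 4) (by norm_num)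
  refine polyFibredGraph_plane_all_member_dense ![Polynomial.X, Polynomial.X ^ 2] (by simp) (by simp)
    _ ⟨0, fun ρ h => hirr ⟨ρ, ?_⟩⟩ 0
  have h' : (((Real.sqrt 2 / 4 : ℝ)) : ℂ) = (ρ : ℂ) := by simpa using h
  exact_mod_cast h'.symm

end Plane

end Summit.Schanuel.Schanuel.Theorems
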